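import Summits.ResolutionOfSingularities.ResolutionOfSingularities.Theorems.EquisingularLiftEquisingularLiftNatDeltaConeLift
import Mathlib
import HarnessLib

/-!
# [OURS · L1 W4.5(b) · EL♮(3)] T-ΔLIFT-CENTRED — a Δ-regular CENTRED cone lift `Φ = G₀ + c·ϖ·M ∈ O[T]_d` of a form
# `g ∈ k[T₀,T₁,T₂]_d` of multiplicity `≥ m` at `q = [1:0:0]`: regular along `ϖ` on the two charts off `q` AND on the two charts
# of the blow-up of the section (crux `EquisingularLiftNat` stmt-20038 / child stmt-20148, line `sections`, DESIGN v6/v7 (TC⁺))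

NOT a statement of any manuscript. Helper file of the chain res-L1-w45b (cell `res-hironaka`, rung L, slot W4.5(b)); AI-written,
weaker than expert review; `--supports stmt-ResolutionOfSingularities-20148 --as helper` by res-L1-w45b-stub-1 (T-ΔLIFT-CENTRED, TAKING
2026-08-27T10:18Z; res-L1-w45b-lead-2 DESIGN v6 (TC⁺) 08:21:51Z «`G̃` := the lift CENTRED at `q` … `+ ϖ·(order ≥ m_q)` terms»).

WHERE IT SITS. res-type-032's T-ΔLIFT (p516044) gives the TC rung a Δ-regular cone lift. The TC⁺ rung first blows up the section
`s_q` over the (at most one) SINGULAR point `q` of the trace `Z = V(g)`; the in-carrier surface `D = V(Φ)` must be (i) CENTRED at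
`s_q` (multiplicity `≥ m = mult_q Z` along the section ⇒ EXACT special fibre of `St_{s_q} D`, res-L1-w45b-stub-3 p515745), (ii) regular
at the special points off `q`, (iii) with REGULAR strict transforms `Φᵘ = Φ(1,u,uv₁)/uᵐ`, `Φᵛ = Φ(1,u₁v,v)/vᵐ` at the special points
of the exceptional curve (Δ-criterion). This file constructs such a `Φ` with ONE genericity parameter `c` for all four charts.

* `exists_isHomogeneous_map_eq_support_subset` (res-type-032's coefficientwise lift with `supp G₀ ⊆ supp g`: centred stays centred),
  `aeval_mem_span_pow_of_forall_le` (monomials in `(T₁,T₂)^m` go to `(wᵐ)` under a substitution with `w ∣ T₁, T₂`),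
  `map_aeval_of_map_comp` / `map_chartU` / `map_chartV` (reduction commutes with the chart substitutions);
* **`exists_isHomogeneous_centred_lift_deltaRegular`** (T-ΔLIFT-CENTRED): `O` a DVR, `ϖ` irreducible, `π : O ↠ k` onto an
  INFINITE field, `ker π = (ϖ)`; `m ≤ d`; `g ∈ k[T₀,T₁,T₂]` a form of degree `d` with `supp g ⊆ {α | m ≤ α₁ + α₂}` (multiplicity
  `≥ m` at `q = [1:0:0]`); on the charts `T₁ = 1`, `T₂ = 1` the bad primes of `g(Tᵢ := 1)` (`∈ 𝔮 ∩ 𝔪_𝔮²`) are finitely many; the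
  downstairs strict transforms `gu, gv ∈ k[X,Y]` (`g(1,X,XY) = Xᵐ·gu`, `g(1,XY,Y) = Yᵐ·gv`) have finitely many bad primes ⟹ THERE
  IS a form `Φ ∈ O[T]_d` with `π Φ = g`, `supp Φ ⊆ {m ≤ α₁ + α₂}`, and polynomials `Φu, Φv ∈ O[X,Y]` with `Φ(1,X,XY) = Xᵐ·Φu`,
  `Φ(1,XY,Y) = Yᵐ·Φv`, `π Φu = gu`, `π Φv = gv`, such that `O[T_{j≠i}]/(Φ(Tᵢ := 1))` (`i = 1, 2`), `O[X,Y]/(Φu)` and `O[X,Y]/(Φv)`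
  are regular local rings at every prime containing `ϖ` — res-type-100's F3b `hreg` binder shape, four times. The chart `T₀ = 1`
  itself is omitted on purpose: its only point not on the other charts is `q`, which is blown up.

Construction: `Φ = G₀ + c·ϖ·M`, `G₀` the support-wise lift, `M` a lift of a form `M̄ ∈ restrictSupport k {|α| = d, m ≤ α₁+α₂}`
avoiding every bad prime (witnesses `T₁^d`, `T₂^d`, `T₀^{d-m}T₁^m`, `T₀^{d-m}T₂^m`; `Submodule.exists_forall_notMem_of_forall_ne_top`),
`π c` off the four exclusion sets of `deltaRegularGeneric_mul_model` (p516044). The finiteness hypotheses for `gu`, `gv` stay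
hypotheses (for square-free `g` they hold: the strict transform of a reduced curve is reduced; not proved here).

References: H. Matsumura, *Commutative Ring Theory* (1986), Thm. 14.2; res-type-032 …NatDeltaConeLift (p516044) / p513713;
res-L1-w45b-lead-2 DESIGN v6 (TC⁺) / TARGET-TCPLUS (OURS planning texts, index only).
-/

set_option linter.dupNamespace false -- mandated namespace `Summit.<Summit>.<Problem>` of this single-conjunct summit
set_option linter.overlappingInstances false -- signatures carry both [IsDomain O] and [IsDiscreteValuationRing O]

noncomputable section

namespace Summit.ResolutionOfSingularities.ResolutionOfSingularities.Cruxes.EquisingularLiftNat.Sections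

open MvPolynomial IsLocalRing Literature.AlgebraicGeometry.Resolution
open Summit.ResolutionOfSingularities.ResolutionOfSingularities.Theorems

/-! ## Lifts with controlled support; chart substitutions -/

section Support

/-- **Forms lift to forms with the same support.** For a surjective `f : R → S` and a form `g ∈ S[x_σ]` of degree `d` there is a
form `G ∈ R[x_σ]` of degree `d` with `f G = g` and `supp G ⊆ supp g` (res-type-032's `exists_isHomogeneous_map_eq_of_surjective`,
p516044, with the support recorded). [folklore] -/
theorem exists_isHomogeneous_map_eq_support_subset {R S : Type*} [CommRing R] [CommRing S] (f : R →+* S)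
    (hf : Function.Surjective f) {σ : Type*} {d : ℕ} (g : MvPolynomial σ S) (hg : g.IsHomogeneous d) :
    ∃ G : MvPolynomial σ R, G.IsHomogeneous d ∧ MvPolynomial.map f G = g ∧ G.support ⊆ g.support := by
  classical
  -- adapted from `exists_isHomogeneous_map_eq_of_surjective` (…NatDeltaConeLift, res-type-032)
  choose s hs using hf
  refine ⟨∑ m ∈ g.support, monomial m (s (g.coeff m)), ?_, ?_, ?_⟩
  · refine IsHomogeneous.sum _ _ _ fun m hm => isHomogeneous_monomial _ ?_
    rw [Finsupp.degree_eq_weight_one]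
    exact hg (mem_support_iff.mp hm)
  · rw [map_sum]
    simp_rw [map_monomial, hs]
    exact support_sum_monomial_coeff g
  · intro α hα
    obtain ⟨m, hm, hαm⟩ := Finset.mem_biUnion.mp (support_sum hα)
    rw [support_monomial] at hαm
    split_ifs at hαm with h
    · exact absurd hαm (Finset.notMem_empty _)
    · rw [Finset.mem_singleton] at hαm
      rwa [hαm]

variable {R S : Type*} [CommRing R] [CommRing S]

/-- **Centred forms are divisible by `wᵐ` after a chart substitution dividing `T₁, T₂` by `w`.** If every monomial of
`P ∈ R[T₀,T₁,T₂]` has `α₁ + α₂ ≥ m` and `v : Fin 3 → S` is a substitution with `w ∣ v 1`, `w ∣ v 2`, then `P(v) ∈ (wᵐ)`.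
[folklore] -/
theorem aeval_mem_span_pow_of_forall_le [Algebra R S] (v : Fin 3 → S) (w : S) (h1 : w ∣ v 1) (h2 : w ∣ v 2) {m : ℕ}
    (P : MvPolynomial (Fin 3) R) (hP : ∀ α ∈ P.support, m ≤ α 1 + α 2) :
    MvPolynomial.aeval v P ∈ Ideal.span {w ^ m} := by
  classical
  rw [P.as_sum, map_sum]
  refine Ideal.sum_mem _ fun α hα => ?_
  rw [MvPolynomial.aeval_monomial, Finsupp.prod_fintype _ _ (fun i => by rw [pow_zero]), Fin.prod_univ_three]
  have hdvd : w ^ m ∣ v 1 ^ α 1 * v 2 ^ α 2 :=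
    (pow_dvd_pow w (hP α hα)).trans (by rw [pow_add]; exact mul_dvd_mul (pow_dvd_pow_of_dvd h1 _) (pow_dvd_pow_of_dvd h2 _))
  obtain ⟨b, hb⟩ := hdvd
  refine Ideal.mem_span_singleton'.mpr ⟨algebraMap R S (coeff α P) * v 0 ^ α 0 * b, ?_⟩
  calc algebraMap R S (coeff α P) * v 0 ^ α 0 * b * w ^ m
      = algebraMap R S (coeff α P) * v 0 ^ α 0 * (w ^ m * b) := by ring
    _ = algebraMap R S (coeff α P) * (v 0 ^ α 0 * v 1 ^ α 1 * v 2 ^ α 2) := by rw [← hb]; ring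

/-- Reduction of coefficients commutes with a chart substitution given by polynomials with integer structure (any `v` with
`map f ∘ v_R = v_S`). [folklore] -/
theorem map_aeval_of_map_comp (f : R →+* S) {σ τ : Type*} (vR : σ → MvPolynomial τ R) (vS : σ → MvPolynomial τ S)
    (hv : ∀ i, MvPolynomial.map f (vR i) = vS i) (P : MvPolynomial σ R) :
    MvPolynomial.map f (MvPolynomial.aeval vR P) = MvPolynomial.aeval vS (MvPolynomial.map f P) := by
  rw [MvPolynomial.aeval_eq_bind₁, MvPolynomial.aeval_eq_bind₁, MvPolynomial.map_bind₁,
    show (fun i => MvPolynomial.map f (vR i)) = vS from funext hv]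

end Support

/-! ## T-ΔLIFT-CENTRED -/

section Centred

variable {O : Type} [CommRing O] [IsDomain O] [IsDiscreteValuationRing O] {ϖ : O}
variable {k : Type} [Field k] [Infinite k]

/-- The chart substitution `T ↦ (1, X, XY)` of the `u`-chart of the blow-up of the section, over any ring. [folklore] -/
theorem map_chartU {R S : Type} [CommRing R] [CommRing S] (f : R →+* S) (i : Fin 3) :
    MvPolynomial.map f ((![1, X 0, X 0 * X 1] : Fin 3 → MvPolynomial (Fin 2) R) i) =
      (![1, X 0, X 0 * X 1] : Fin 3 → MvPolynomial (Fin 2) S) i := by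
  fin_cases i <;> simp

/-- The chart substitution `T ↦ (1, XY, Y)` of the `v`-chart, over any ring. [folklore] -/
theorem map_chartV {R S : Type} [CommRing R] [CommRing S] (f : R →+* S) (i : Fin 3) :
    MvPolynomial.map f ((![1, X 0 * X 1, X 1] : Fin 3 → MvPolynomial (Fin 2) R) i) =
      (![1, X 0 * X 1, X 1] : Fin 3 → MvPolynomial (Fin 2) S) i := by
  fin_cases i <;> simp

/-- **T-ΔLIFT-CENTRED — existence of a Δ-regular centred cone lift.** See the module docstring.
[cite: Matsumura1987, Thm. 14.2] [OURS · L1 W4.5b] T-ΔLIFT-CENTRED toward `stub_elnat_three_isolated_nontc` /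
`stub_elnat_tcPlusPointResolution` (DESIGN v6/v7 (TC⁺)); NOT a statement of the manuscript. -/
theorem exists_isHomogeneous_centred_lift_deltaRegular (hϖ : Irreducible ϖ) (π : O →+* k) (hπ : Function.Surjective π)
    (hker : RingHom.ker π = Ideal.span {ϖ}) {d m : ℕ} (hmd : m ≤ d) (g : MvPolynomial (Fin 3) k) (hg : g.IsHomogeneous d)
    (hcen : ∀ α ∈ g.support, m ≤ α 1 + α 2)
    -- finitely many bad primes on the charts `T₁ = 1`, `T₂ = 1`
    (hfin₁ : {𝔮 : PrimeSpectrum (MvPolynomial {j : Fin 3 // j ≠ 1} k) |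
      dehomogenize 1 g ∈ 𝔮.asIdeal ∧
      algebraMap (MvPolynomial {j : Fin 3 // j ≠ 1} k) (Localization.AtPrime 𝔮.asIdeal) (dehomogenize 1 g) ∈
        maximalIdeal (Localization.AtPrime 𝔮.asIdeal) ^ 2}.Finite)
    (hfin₂ : {𝔮 : PrimeSpectrum (MvPolynomial {j : Fin 3 // j ≠ 2} k) |
      dehomogenize 2 g ∈ 𝔮.asIdeal ∧
      algebraMap (MvPolynomial {j : Fin 3 // j ≠ 2} k) (Localization.AtPrime 𝔮.asIdeal) (dehomogenize 2 g) ∈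
        maximalIdeal (Localization.AtPrime 𝔮.asIdeal) ^ 2}.Finite)
    -- the downstairs strict transforms on the two charts of the blow-up of `q`, with finitely many bad primes
    (gu gv : MvPolynomial (Fin 2) k)
    (hgu : MvPolynomial.aeval (![1, X 0, X 0 * X 1] : Fin 3 → MvPolynomial (Fin 2) k) g = X 0 ^ m * gu)
    (hgv : MvPolynomial.aeval (![1, X 0 * X 1, X 1] : Fin 3 → MvPolynomial (Fin 2) k) g = X 1 ^ m * gv)
    (hfinu : {𝔮 : PrimeSpectrum (MvPolynomial (Fin 2) k) | gu ∈ 𝔮.asIdeal ∧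
      algebraMap (MvPolynomial (Fin 2) k) (Localization.AtPrime 𝔮.asIdeal) gu ∈
        maximalIdeal (Localization.AtPrime 𝔮.asIdeal) ^ 2}.Finite)
    (hfinv : {𝔮 : PrimeSpectrum (MvPolynomial (Fin 2) k) | gv ∈ 𝔮.asIdeal ∧
      algebraMap (MvPolynomial (Fin 2) k) (Localization.AtPrime 𝔮.asIdeal) gv ∈
        maximalIdeal (Localization.AtPrime 𝔮.asIdeal) ^ 2}.Finite) :
    ∃ Φ : MvPolynomial (Fin 3) O, Φ.IsHomogeneous d ∧ MvPolynomial.map π Φ = g ∧ (∀ α ∈ Φ.support, m ≤ α 1 + α 2) ∧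
      ∃ Φu Φv : MvPolynomial (Fin 2) O,
        MvPolynomial.aeval (![1, X 0, X 0 * X 1] : Fin 3 → MvPolynomial (Fin 2) O) Φ = X 0 ^ m * Φu ∧
        MvPolynomial.aeval (![1, X 0 * X 1, X 1] : Fin 3 → MvPolynomial (Fin 2) O) Φ = X 1 ^ m * Φv ∧
        MvPolynomial.map π Φu = gu ∧ MvPolynomial.map π Φv = gv ∧
        (∀ (Q : Ideal (MvPolynomial {j : Fin 3 // j ≠ 1} O ⧸ Ideal.span {dehomogenize 1 Φ})) [Q.IsPrime],
          Ideal.Quotient.mk (Ideal.span {dehomogenize 1 Φ}) (C ϖ : MvPolynomial {j : Fin 3 // j ≠ 1} O) ∈ Q →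
            IsRegularLocalRing (Localization.AtPrime Q)) ∧
        (∀ (Q : Ideal (MvPolynomial {j : Fin 3 // j ≠ 2} O ⧸ Ideal.span {dehomogenize 2 Φ})) [Q.IsPrime],
          Ideal.Quotient.mk (Ideal.span {dehomogenize 2 Φ}) (C ϖ : MvPolynomial {j : Fin 3 // j ≠ 2} O) ∈ Q →
            IsRegularLocalRing (Localization.AtPrime Q)) ∧
        (∀ (Q : Ideal (MvPolynomial (Fin 2) O ⧸ Ideal.span {Φu})) [Q.IsPrime],
          Ideal.Quotient.mk (Ideal.span {Φu}) (C ϖ : MvPolynomial (Fin 2) O) ∈ Q → IsRegularLocalRing (Localization.AtPrime Q)) ∧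
        (∀ (Q : Ideal (MvPolynomial (Fin 2) O ⧸ Ideal.span {Φv})) [Q.IsPrime],
          Ideal.Quotient.mk (Ideal.span {Φv}) (C ϖ : MvPolynomial (Fin 2) O) ∈ Q → IsRegularLocalRing (Localization.AtPrime Q)) := by
  classical
  have hπϖ : π ϖ = 0 := by
    rw [← RingHom.mem_ker, hker]
    exact Ideal.mem_span_singleton_self ϖ
  -- Step 0: the centred degree-`d` forms over `k`
  let V : Submodule k (MvPolynomial (Fin 3) k) := restrictSupport k {α | α.degree = d ∧ m ≤ α 1 + α 2}
  have hVsupp : ∀ M ∈ V, ((M.support : Finset (Fin 3 →₀ ℕ)) : Set (Fin 3 →₀ ℕ)) ⊆ {α | α.degree = d ∧ m ≤ α 1 + α 2} :=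
    fun M hM => hM
  have hVhom : ∀ M ∈ V, MvPolynomial.IsHomogeneous M d := by
    intro M hM α hα
    have h := (hVsupp M hM (Finset.mem_coe.mpr (mem_support_iff.mpr hα))).1
    rw [Finsupp.degree_eq_weight_one] at h
    exact h
  have hVcen : ∀ M ∈ V, ∀ α ∈ M.support, m ≤ α 1 + α 2 := fun M hM α hα =>
    (hVsupp M hM (Finset.mem_coe.mpr hα)).2
  have hmono : ∀ α : Fin 3 →₀ ℕ, α.degree = d → m ≤ α 1 + α 2 → (monomial α (1 : k)) ∈ V := by
    intro α h1 h2
    rw [monomial_mem_restrictSupport]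
    exact Or.inl ⟨h1, h2⟩
  -- the four families of bad primes and the bad subspaces of `V`
  let B1 := hfin₁.toFinset
  let B2 := hfin₂.toFinset
  let Bu := hfinu.toFinset
  let Bv := hfinv.toFinset
  let pdehom : ∀ i : Fin 3, Ideal (MvPolynomial {j : Fin 3 // j ≠ i} k) → Submodule k V := fun i 𝔮 =>
    (𝔮.restrictScalars k).comap ((dehomogenize i).toLinearMap ∘ₗ V.subtype)
  let pchart : (Fin 3 → MvPolynomial (Fin 2) k) → MvPolynomial (Fin 2) k → Ideal (MvPolynomial (Fin 2) k) →
      Submodule k V :=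
    fun v w 𝔮 => ((𝔮.restrictScalars k).map (LinearMap.mulLeft k w)).comap ((MvPolynomial.aeval v).toLinearMap ∘ₗ V.subtype)
  let p : (B1 ⊕ B2) ⊕ (Bu ⊕ Bv) → Submodule k V :=
    Sum.elim (Sum.elim (fun b => pdehom 1 b.1.asIdeal) (fun b => pdehom 2 b.1.asIdeal))
      (Sum.elim (fun b => pchart (![1, X 0, X 0 * X 1]) (X 0 ^ m) b.1.asIdeal)
        (fun b => pchart (![1, X 0 * X 1, X 1]) (X 1 ^ m) b.1.asIdeal))
  -- membership unfolding
  have hmem_dehom : ∀ (i : Fin 3) (𝔮 : Ideal (MvPolynomial {j : Fin 3 // j ≠ i} k)) (M : V),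
      M ∈ pdehom i 𝔮 ↔ dehomogenize i (M : MvPolynomial (Fin 3) k) ∈ 𝔮 := fun i 𝔮 M => Iff.rfl
  have hmem_chart : ∀ (v : Fin 3 → MvPolynomial (Fin 2) k) (w : MvPolynomial (Fin 2) k) (𝔮 : Ideal (MvPolynomial (Fin 2) k))
      (M : V), M ∈ pchart v w 𝔮 ↔ ∃ q ∈ 𝔮, w * q = MvPolynomial.aeval v (M : MvPolynomial (Fin 3) k) := by
    intro v w 𝔮 M
    change (MvPolynomial.aeval v (M : MvPolynomial (Fin 3) k)) ∈ ((𝔮.restrictScalars k).map (LinearMap.mulLeft k w)) ↔ _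
    rw [Submodule.mem_map]
    simp only [Submodule.restrictScalars_mem, LinearMap.mulLeft_apply]
  -- properness of the bad subspaces: charts `T₁ = 1`, `T₂ = 1` (witness `Tᵢ^d`)
  have hdehom_ne_top : ∀ (i : Fin 3), i ≠ 0 → ∀ 𝔮 : Ideal (MvPolynomial {j : Fin 3 // j ≠ i} k), 𝔮 ≠ ⊤ →
      pdehom i 𝔮 ≠ ⊤ := by
    intro i hi 𝔮 h𝔮 htop
    have hXi : (X i ^ d : MvPolynomial (Fin 3) k) ∈ V := by
      rw [X_pow_eq_monomial]
      refine hmono _ (Finsupp.degree_single _ _) ?_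
      fin_cases i
      · exact absurd rfl hi
      · simp [hmd]
      · simp [hmd]
    have hmem : (⟨_, hXi⟩ : V) ∈ pdehom i 𝔮 := by rw [htop]; exact Submodule.mem_top
    rw [hmem_dehom] at hmem
    change dehomogenize i (X i ^ d : MvPolynomial (Fin 3) k) ∈ 𝔮 at hmem
    rw [map_pow, MvPolynomial.aeval_X, killVar_self, one_pow] at hmem
    exact h𝔮 ((Ideal.eq_top_iff_one _).mpr hmem)
  -- properness: the two blow-up charts (witnesses `T₀^{d-m} T₁^m`, `T₀^{d-m} T₂^m`)
  have hchart_ne_top : ∀ (j : Fin 3) (l : Fin 2) (v : Fin 3 → MvPolynomial (Fin 2) k),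
      j ≠ 0 → m ≤ (Finsupp.single 0 (d - m) + Finsupp.single j m : Fin 3 →₀ ℕ) 1 +
        (Finsupp.single 0 (d - m) + Finsupp.single j m : Fin 3 →₀ ℕ) 2 →
      MvPolynomial.aeval v (monomial (Finsupp.single 0 (d - m) + Finsupp.single j m) (1 : k)) = X l ^ m →
      ∀ 𝔮 : Ideal (MvPolynomial (Fin 2) k), 𝔮 ≠ ⊤ → pchart v (X l ^ m) 𝔮 ≠ ⊤ := by
    intro j l v _ hle hev 𝔮 h𝔮 htop
    have hαV : (monomial (Finsupp.single 0 (d - m) + Finsupp.single j m) (1 : k)) ∈ V := by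
      refine hmono _ ?_ hle
      rw [map_add, Finsupp.degree_single, Finsupp.degree_single, Nat.sub_add_cancel hmd]
    have hmem : (⟨_, hαV⟩ : V) ∈ pchart v (X l ^ m) 𝔮 := by rw [htop]; exact Submodule.mem_top
    rw [hmem_chart] at hmem
    obtain ⟨q, hq, hwq⟩ := hmem
    change X l ^ m * q = MvPolynomial.aeval v (monomial (Finsupp.single 0 (d - m) + Finsupp.single j m) (1 : k)) at hwq
    rw [hev] at hwq
    have hq1 : q = 1 := mul_left_cancel₀ (pow_ne_zero m (MvPolynomial.X_ne_zero l)) (hwq.trans (mul_one _).symm)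
    rw [hq1] at hq
    exact h𝔮 ((Ideal.eq_top_iff_one _).mpr hq)
  have hevU : MvPolynomial.aeval (![1, X 0, X 0 * X 1] : Fin 3 → MvPolynomial (Fin 2) k)
      (monomial (Finsupp.single 0 (d - m) + Finsupp.single 1 m) (1 : k)) = X 0 ^ m := by
    rw [MvPolynomial.aeval_monomial, map_one, one_mul, Finsupp.prod_fintype _ _ (fun i => by rw [pow_zero]),
      Fin.prod_univ_three]
    simp
  have hevV : MvPolynomial.aeval (![1, X 0 * X 1, X 1] : Fin 3 → MvPolynomial (Fin 2) k)
      (monomial (Finsupp.single 0 (d - m) + Finsupp.single 2 m) (1 : k)) = X 1 ^ m := by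
    rw [MvPolynomial.aeval_monomial, map_one, one_mul, Finsupp.prod_fintype _ _ (fun i => by rw [pow_zero]),
      Fin.prod_univ_three]
    simp
  have hp : ∀ t, p t ≠ ⊤ := by
    rintro ((b | b) | (b | b))
    · exact hdehom_ne_top 1 (by decide) _ b.1.isPrime.ne_top
    · exact hdehom_ne_top 2 (by decide) _ b.1.isPrime.ne_top
    · exact hchart_ne_top 1 0 _ (by decide) (by simp) hevU _ b.1.isPrime.ne_top
    · exact hchart_ne_top 2 1 _ (by decide) (by simp) hevV _ b.1.isPrime.ne_top
  -- Step 1: a centred form `M̄` of degree `d` avoiding every bad prime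
  obtain ⟨Mb, hMb⟩ := Submodule.exists_forall_notMem_of_forall_ne_top p hp
  have hMb1 : ∀ b : B1, dehomogenize 1 (Mb : MvPolynomial (Fin 3) k) ∉ b.1.asIdeal := fun b h =>
    hMb (Sum.inl (Sum.inl b)) ((hmem_dehom 1 _ Mb).mpr h)
  have hMb2 : ∀ b : B2, dehomogenize 2 (Mb : MvPolynomial (Fin 3) k) ∉ b.1.asIdeal := fun b h =>
    hMb (Sum.inl (Sum.inr b)) ((hmem_dehom 2 _ Mb).mpr h)
  have hMbu : ∀ b : Bu, ∀ q, X 0 ^ m * q =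
      MvPolynomial.aeval (![1, X 0, X 0 * X 1] : Fin 3 → MvPolynomial (Fin 2) k) (Mb : MvPolynomial (Fin 3) k) →
      q ∉ b.1.asIdeal := fun b q hq h =>
    hMb (Sum.inr (Sum.inl b)) ((hmem_chart _ _ _ Mb).mpr ⟨q, h, hq⟩)
  have hMbv : ∀ b : Bv, ∀ q, X 1 ^ m * q =
      MvPolynomial.aeval (![1, X 0 * X 1, X 1] : Fin 3 → MvPolynomial (Fin 2) k) (Mb : MvPolynomial (Fin 3) k) →
      q ∉ b.1.asIdeal := fun b q hq h =>
    hMb (Sum.inr (Sum.inr b)) ((hmem_chart _ _ _ Mb).mpr ⟨q, h, hq⟩)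
  -- Step 2: homogeneous centred lifts `G₀` of `g` and `M` of `M̄`
  obtain ⟨G, hG, hGg, hGsupp⟩ := exists_isHomogeneous_map_eq_support_subset π hπ g hg
  obtain ⟨M, hM, hMM, hMsupp⟩ := exists_isHomogeneous_map_eq_support_subset π hπ (Mb : MvPolynomial (Fin 3) k)
    (hVhom _ Mb.2)
  have hGcen : ∀ α ∈ G.support, m ≤ α 1 + α 2 := fun α hα => hcen α (hGsupp hα)
  have hMcen : ∀ α ∈ M.support, m ≤ α 1 + α 2 := fun α hα => hVcen _ Mb.2 α (hMsupp hα)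
  -- Step 3: the strict transforms on the two blow-up charts (divisibility by `Xᵐ`, `Yᵐ`)
  have hdivU : ∀ P : MvPolynomial (Fin 3) O, (∀ α ∈ P.support, m ≤ α 1 + α 2) →
      ∃ Pu, MvPolynomial.aeval (![1, X 0, X 0 * X 1] : Fin 3 → MvPolynomial (Fin 2) O) P = X 0 ^ m * Pu := by
    intro P hP
    obtain ⟨Pu, hPu⟩ := Ideal.mem_span_singleton'.mp (aeval_mem_span_pow_of_forall_le
      (![1, X 0, X 0 * X 1] : Fin 3 → MvPolynomial (Fin 2) O) (X 0) (by simp) (by simp) P hP)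
    exact ⟨Pu, by rw [← hPu, mul_comm]⟩
  have hdivV : ∀ P : MvPolynomial (Fin 3) O, (∀ α ∈ P.support, m ≤ α 1 + α 2) →
      ∃ Pv, MvPolynomial.aeval (![1, X 0 * X 1, X 1] : Fin 3 → MvPolynomial (Fin 2) O) P = X 1 ^ m * Pv := by
    intro P hP
    obtain ⟨Pv, hPv⟩ := Ideal.mem_span_singleton'.mp (aeval_mem_span_pow_of_forall_le
      (![1, X 0 * X 1, X 1] : Fin 3 → MvPolynomial (Fin 2) O) (X 1) (by simp) (by simp) P hP)
    exact ⟨Pv, by rw [← hPv, mul_comm]⟩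
  obtain ⟨Gu, hGu⟩ := hdivU G hGcen
  obtain ⟨Mu, hMu⟩ := hdivU M hMcen
  obtain ⟨Gv, hGv⟩ := hdivV G hGcen
  obtain ⟨Mv, hMv⟩ := hdivV M hMcen
  have hredU : ∀ (P : MvPolynomial (Fin 3) O) (Pu : MvPolynomial (Fin 2) O),
      MvPolynomial.aeval (![1, X 0, X 0 * X 1] : Fin 3 → MvPolynomial (Fin 2) O) P = X 0 ^ m * Pu →
      X 0 ^ m * MvPolynomial.map π Pu =
        MvPolynomial.aeval (![1, X 0, X 0 * X 1] : Fin 3 → MvPolynomial (Fin 2) k) (MvPolynomial.map π P) := by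
    intro P Pu h
    rw [← map_aeval_of_map_comp π _ _ (map_chartU π) P, h, map_mul, map_pow, map_X]
  have hredV : ∀ (P : MvPolynomial (Fin 3) O) (Pv : MvPolynomial (Fin 2) O),
      MvPolynomial.aeval (![1, X 0 * X 1, X 1] : Fin 3 → MvPolynomial (Fin 2) O) P = X 1 ^ m * Pv →
      X 1 ^ m * MvPolynomial.map π Pv =
        MvPolynomial.aeval (![1, X 0 * X 1, X 1] : Fin 3 → MvPolynomial (Fin 2) k) (MvPolynomial.map π P) := by
    intro P Pv h
    rw [← map_aeval_of_map_comp π _ _ (map_chartV π) P, h, map_mul, map_pow, map_X]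
  have hGugu : MvPolynomial.map π Gu = gu := by
    have h := hredU G Gu hGu
    rw [hGg, hgu] at h
    exact mul_left_cancel₀ (pow_ne_zero m (MvPolynomial.X_ne_zero 0)) h
  have hGvgv : MvPolynomial.map π Gv = gv := by
    have h := hredV G Gv hGv
    rw [hGg, hgv] at h
    exact mul_left_cancel₀ (pow_ne_zero m (MvPolynomial.X_ne_zero 1)) h
  -- Step 4: the four exclusion sets of the generic-lift theorem
  have hGi : ∀ i : Fin 3, MvPolynomial.map π (dehomogenize i G) = dehomogenize i g := fun i => by
    rw [map_dehomogenize, hGg]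
  have hMi : ∀ i : Fin 3, MvPolynomial.map π (dehomogenize i M) = dehomogenize i (Mb : MvPolynomial (Fin 3) k) := fun i => by
    rw [map_dehomogenize, hMM]
  obtain ⟨S1, hS1⟩ := deltaRegularGeneric_mul_model hϖ π hπ hker (dehomogenize 1 G) (dehomogenize 1 M)
    (by rw [hGi]; exact hfin₁)
    (by
      intro 𝔮 h1 h2
      rw [hMi]
      rw [hGi] at h1 h2
      exact hMb1 ⟨𝔮, hfin₁.mem_toFinset.mpr ⟨h1, h2⟩⟩)
  obtain ⟨S2, hS2⟩ := deltaRegularGeneric_mul_model hϖ π hπ hker (dehomogenize 2 G) (dehomogenize 2 M)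
    (by rw [hGi]; exact hfin₂)
    (by
      intro 𝔮 h1 h2
      rw [hMi]
      rw [hGi] at h1 h2
      exact hMb2 ⟨𝔮, hfin₂.mem_toFinset.mpr ⟨h1, h2⟩⟩)
  obtain ⟨Su, hSu⟩ := deltaRegularGeneric_mul_model hϖ π hπ hker Gu Mu
    (by rw [hGugu]; exact hfinu)
    (by
      intro 𝔮 h1 h2
      rw [hGugu] at h1 h2
      have h := hredU M Mu hMu
      rw [hMM] at h
      exact hMbu ⟨𝔮, hfinu.mem_toFinset.mpr ⟨h1, h2⟩⟩ _ h)
  obtain ⟨Sv, hSv⟩ := deltaRegularGeneric_mul_model hϖ π hπ hker Gv Mv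
    (by rw [hGvgv]; exact hfinv)
    (by
      intro 𝔮 h1 h2
      rw [hGvgv] at h1 h2
      have h := hredV M Mv hMv
      rw [hMM] at h
      exact hMbv ⟨𝔮, hfinv.mem_toFinset.mpr ⟨h1, h2⟩⟩ _ h)
  -- Step 5: one value of `c` good for all four charts
  obtain ⟨y, hy⟩ := Infinite.exists_notMem_finset (S1 ∪ S2 ∪ (Su ∪ Sv))
  obtain ⟨c, rfl⟩ := hπ y
  simp only [Finset.mem_union, not_or] at hy
  obtain ⟨⟨hc1, hc2⟩, hcu, hcv⟩ := hy
  -- the centred cone `Φ = G₀ + c·ϖ·M` and its strict transforms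
  refine ⟨G + C (c * ϖ) * M, hG.add (hM.C_mul _), ?_, ?_, Gu + C (c * ϖ) * Mu, Gv + C (c * ϖ) * Mv,
    ?_, ?_, ?_, ?_, ?_, ?_, ?_, ?_⟩
  · rw [map_add_C_mul_mul_of_map_eq_zero π hπϖ, hGg]
  · intro α hα
    rcases Finset.mem_union.mp (support_add hα) with h | h
    · exact hGcen α h
    · rw [← smul_eq_C_mul] at h
      exact hMcen α (support_smul h)
  · rw [map_add, map_mul, hGu, hMu, MvPolynomial.algHom_C, MvPolynomial.algebraMap_eq]
    ring
  · rw [map_add, map_mul, hGv, hMv, MvPolynomial.algHom_C, MvPolynomial.algebraMap_eq]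
    ring
  · rw [map_add_C_mul_mul_of_map_eq_zero π hπϖ, hGugu]
  · rw [map_add_C_mul_mul_of_map_eq_zero π hπϖ, hGvgv]
  · intro Q _ hQ
    have hdehom : dehomogenize 1 (G + C (c * ϖ) * M) = dehomogenize 1 G + C (c * ϖ) * dehomogenize 1 M := by
      rw [map_add, map_mul, MvPolynomial.aeval_C, MvPolynomial.algebraMap_eq]
    have key := hS1 c hc1
    revert Q
    rw [hdehom]
    intro Q _ hQ
    exact key Q hQ
  · intro Q _ hQ
    have hdehom : dehomogenize 2 (G + C (c * ϖ) * M) = dehomogenize 2 G + C (c * ϖ) * dehomogenize 2 M := by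
      rw [map_add, map_mul, MvPolynomial.aeval_C, MvPolynomial.algebraMap_eq]
    have key := hS2 c hc2
    revert Q
    rw [hdehom]
    intro Q _ hQ
    exact key Q hQ
  · intro Q _ hQ
    exact hSu c hcu Q hQ
  · intro Q _ hQ
    exact hSv c hcv Q hQ

end Centred

end Summit.ResolutionOfSingularities.ResolutionOfSingularities.Cruxes.EquisingularLiftNat.Sections

end
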